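import Summits.NavierStokesRegularity.NavierStokesRegularity.Theorems.ArgmaxDoorsNearEngineWeighted
import Mathlib.Analysis.SpecialFunctions.Integrals.Basic
import HarnessLib

/-!
# ArgmaxNearDoorsBudget — door family S36 §A «ArgmaxNearDoors», plates N♭ «SlabDissipationBudget» and
# N♭β «ShrinkingDissipationBudget», PROVED

S-door lane (ns-sfl-p1 g5, first-announce 2026-08-28T17:00:09Z; LEAD ns-s30-p1 g3; texts of record nsreg-p1 g30
ROUND-34 §A `r34/Sketch36A.lean` sha16 3ebc53b38700dd90; `--supports stmt-NavierStokesRegularity-0056 --as helper`).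

The two DISSIPATION BUDGETS of §A, i.e. the LEAD's `exists_dissipation_budget` /
`exists_dissipation_budget_weighted` (`ArgmaxDoorsNearEngine(Weighted)`, closed slab `[0,L]`, enstrophy spelled
`(eLpNorm (curl (v s)) 2).toReal`) TIME-TRANSLATED to the start `t₁` of an end slab of the frame `[0,T)`, with the
energy at `t₁` traded for the energy at `0` (Tao's energy bound) and the enstrophy spelled `(∫‖ω(s)‖²)^{1/2}`:

* `exists_energy_ratio` — universal `C_T ≥ 0`: `∫‖u(t₁)‖² ≤ C_T ∫‖u(0)‖²` for `t₁ ∈ [0,T)` in the frame;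
* `slabDissipationBudget` — plate N♭ (text verbatim): `∫_{t₁}^{t} (∫‖ω(s)‖²)^{1/2} ds ≤ √(t − t₁)·√(C‖u(0)‖²₂/ν)`;
* `shrinkingDissipationBudget` — plate N♭β (text verbatim): with the shrinking-ball weight
  `k(s) = (4π/(3(r₀(T−s)^β)³))^{1/2}`, `0 < β < 1/3`,
  `∫_{t₁}^{t} k(s)(∫‖ω(s)‖²)^{1/2} ds ≤ (4π/(3r₀³))^{1/2}·((T−t₁)^{1−3β}/(1−3β))^{1/2}·√(C‖u(0)‖²₂/ν)`
  (`∫_{t₁}^{t}(T−s)^{−3β} ds = ((T−t₁)^{1−3β} − (T−t)^{1−3β})/(1−3β)`, `integral_rpow`).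
The by-name forms `slabDissipationBudget_holds : SlabDissipationBudget` etc. follow by `exact` once the §A texts
(P0-36A) are in the tree.

WHAT THIS IS NOT: bookkeeping plates of regularity CRITERIA (doors S36-C♭/C♯) about hypothetical blow-up; item 0056
`NoTypeII` and NS regularity are NOT proved; no Literature fact is a hypothesis; nothing here is a route or a summit
statement.
-/

-- the summit's problem namespace repeats the summit name (tree layout)
set_option linter.dupNamespace false

noncomputable section

open MeasureTheory Set Function Filter Metric Real InnerProductSpace
open scoped ENNReal NNReal RealInnerProductSpace Topology ContDiff

namespace Summit.NavierStokesRegularity.NavierStokesRegularity.Theorems.ArgmaxDoors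

open Literature.Analysis Literature.Analysis.FluidPDE

/-! ### The energy at the slab start against the initial energy -/

/-- **Energy ratio in the frame** (Tao's energy bound, Bochner form): there is a universal `C ≥ 0` such that for
every classical unforced solution on `[0,T)` with all `L²` Sobolev seminorms bounded on every `[0,T'']`, `T'' < T`,
and every `t₁ ∈ [0,T)`: `∫‖u(t₁)‖² ≤ C·∫‖u(0)‖²`. -/
theorem exists_energy_ratio : ∃ C : ℝ, 0 ≤ C ∧
    ∀ (ν T : ℝ) (u : ℝ → (EuclideanSpace ℝ (Fin 3)) → (EuclideanSpace ℝ (Fin 3)))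
      (p : ℝ → (EuclideanSpace ℝ (Fin 3)) → ℝ), 0 < ν →
      IsClassicalNSSolutionOn (Ico 0 T) ν 0 u p →
      (∀ T'' < T, HasBoundedSobolevNormsOn (Icc 0 T'') u) →
      ∀ t₁ ∈ Ico 0 T, ∫ y, ‖u t₁ y‖ ^ 2 ≤ C * ∫ y, ‖u 0 y‖ ^ 2 := by
  obtain ⟨CT, hCTtop, hTao⟩ := tao_finite_energy_smooth_energy_bound_holds
  refine ⟨max 1 CT.toReal, by positivity, ?_⟩
  intro ν T u p hν hsol hreg t₁ ht₁
  have hE0 : 0 ≤ ∫ y, ‖u 0 y‖ ^ 2 := integral_nonneg fun y => sq_nonneg _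
  rcases eq_or_lt_of_le ht₁.1 with h0 | hpos
  · rw [← h0]
    calc ∫ y, ‖u 0 y‖ ^ 2 = 1 * ∫ y, ‖u 0 y‖ ^ 2 := (one_mul _).symm
      _ ≤ max 1 CT.toReal * ∫ y, ‖u 0 y‖ ^ 2 := mul_le_mul_of_nonneg_right (le_max_left _ _) hE0
  · -- restrict to the closed slab `[0, t₁]`
    have hS : IsClassicalNSSolutionOn (Icc 0 t₁) ν 0 u p :=
      hsol.mono (Icc_subset_Ico_right ht₁.2) (uniqueDiffOn_Icc hpos)
    have hB : HasBoundedSobolevNormsOn (Icc 0 t₁) u := hreg t₁ ht₁.2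
    obtain ⟨B₁, B₂, -, -, hpk⟩ := IntenseSetDoors.slice_package hS hB
    have hE : ∃ A : ℝ≥0∞, A < ⊤ ∧ ∀ s ∈ Icc 0 t₁, ∫⁻ x, ‖u s x‖ₑ ^ 2 ≤ A := by
      obtain ⟨C0, hC0⟩ := hB 0
      refine ⟨C0, ENNReal.coe_lt_top, fun s hs => ?_⟩
      refine le_trans (le_of_eq (lintegral_congr fun x => ?_)) (hC0 s hs)
      rw [← ofReal_norm, ← ofReal_norm, norm_iteratedFDeriv_zero]
    obtain ⟨hbound, -⟩ := hTao ν t₁ hν hpos u p hS hE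
    have h1 := hbound t₁ ⟨ht₁.1, le_rfl⟩
    -- Bochner form
    obtain ⟨-, -, i0, -, -, -, -⟩ := hpk 0 ⟨le_rfl, hpos.le⟩
    obtain ⟨-, -, i1, -, -, -, -⟩ := hpk t₁ ⟨ht₁.1, le_rfl⟩
    have hconv : ∀ s, Integrable (fun y => ‖u s y‖ ^ 2) →
        ∫⁻ x, ‖u s x‖ₑ ^ 2 = ENNReal.ofReal (∫ y, ‖u s y‖ ^ 2) := by
      intro s hi
      rw [ofReal_integral_eq_lintegral_ofReal hi (Eventually.of_forall fun x => sq_nonneg _)]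
      refine lintegral_congr fun x => ?_
      rw [← ofReal_norm, ENNReal.ofReal_pow (norm_nonneg _)]
    rw [hconv t₁ i1, hconv 0 i0, ← ENNReal.ofReal_toReal hCTtop.ne,
      ← ENNReal.ofReal_mul ENNReal.toReal_nonneg, ENNReal.ofReal_le_ofReal_iff (by positivity)] at h1
    exact h1.trans (mul_le_mul_of_nonneg_right (le_max_right _ _) hE0)

/-! ### Slices of the frame on a closed end slab -/

/-- On a closed slab `[0,t] ⊂ [0,T)` (`t > 0`) of the frame, every vorticity slice is continuous with
`∫‖ω(s)‖² < ∞`, and `(eLpNorm (curl (u s)) 2).toReal = (∫‖ω(s)‖²)^{1/2}`. -/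
theorem toReal_eLpNorm_curl_eq_rpow {ν T : ℝ}
    {u : ℝ → (EuclideanSpace ℝ (Fin 3)) → (EuclideanSpace ℝ (Fin 3))}
    {p : ℝ → (EuclideanSpace ℝ (Fin 3)) → ℝ} (hsol : IsClassicalNSSolutionOn (Ico 0 T) ν 0 u p)
    (hreg : ∀ T'' < T, HasBoundedSobolevNormsOn (Icc 0 T'') u) {t : ℝ} (ht : 0 < t) (htT : t < T)
    {s : ℝ} (hs : s ∈ Icc 0 t) :
    (eLpNorm (curl (u s)) 2 volume).toReal = (∫ y, ‖curl (u s) y‖ ^ 2) ^ (1 / (2 : ℝ)) := by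
  have hS : IsClassicalNSSolutionOn (Icc 0 t) ν 0 u p :=
    hsol.mono (Icc_subset_Ico_right htT) (uniqueDiffOn_Icc ht)
  obtain ⟨B₁, B₂, -, -, hpk⟩ := IntenseSetDoors.slice_package hS (hreg t htT)
  obtain ⟨hv3, -, -, i1, -, -, -⟩ := hpk s hs
  have hcont : Continuous (curl (u s)) := continuous_curl (hv3.of_le (by norm_cast))
  have hIω : Integrable fun x => ‖curl (u s) x‖ ^ 2 := by
    refine (i1.const_mul (‖curlCLM‖ ^ 2)).mono' ((hcont.norm.pow 2).aestronglyMeasurable)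
      (Eventually.of_forall fun x => ?_)
    rw [Real.norm_of_nonneg (sq_nonneg _), ← mul_pow]
    exact pow_le_pow_left₀ (norm_nonneg _) (norm_curl_le (u s) x) 2
  rw [toReal_eLpNorm_two_eq_sqrt hcont hIω, Real.sqrt_eq_rpow]

/-! ### Plate N♭ «SlabDissipationBudget» -/

/-- plate N♭ «SlabDissipationBudget» (nsreg-p1 ROUND-34 §A, `Sketch36A.lean` l.142), PROVED — the text verbatim:
universal `C ≥ 0`; in the frame, for `0 ≤ t₁ ≤ t < T`, `∫_{t₁}^{t} (∫‖ω(s)‖²)^{1/2} ds ≤ √(t − t₁)·√(C‖u(0)‖²₂/ν)`.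
Proof: the LEAD's `exists_dissipation_budget` on the translated solution `u(t₁ + ·)` over `[0, t − t₁]`, then
`∫‖u(t₁)‖² ≤ C_T ∫‖u(0)‖²` (`exists_energy_ratio`). -/
theorem slabDissipationBudget : ∃ C : ℝ, 0 ≤ C ∧
    ∀ (ν T : ℝ) (u : ℝ → (EuclideanSpace ℝ (Fin 3)) → (EuclideanSpace ℝ (Fin 3)))
      (p : ℝ → (EuclideanSpace ℝ (Fin 3)) → ℝ), 0 < ν →
      IsClassicalNSSolutionOn (Ico 0 T) ν 0 u p →
      (∀ T'' < T, HasBoundedSobolevNormsOn (Icc 0 T'') u) →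
      ∀ (t₁ t : ℝ), 0 ≤ t₁ → t₁ ≤ t → t < T →
        ∫ s in t₁..t, (∫ y, ‖curl (u s) y‖ ^ 2) ^ (1 / (2 : ℝ)) ≤
          Real.sqrt (t - t₁) * Real.sqrt (C * (∫ y, ‖u 0 y‖ ^ 2) / ν) := by
  obtain ⟨C₁, hC₁0, hbud⟩ := exists_dissipation_budget
  obtain ⟨CT, hCT0, hrat⟩ := exists_energy_ratio
  refine ⟨C₁ * CT, by positivity, ?_⟩
  intro ν T u p hν hsol hreg t₁ t ht₁ ht₁t htT
  rcases eq_or_lt_of_le ht₁t with heq | hlt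
  · subst heq
    rw [intervalIntegral.integral_same, sub_self, Real.sqrt_zero, zero_mul]
  have hL : 0 < t - t₁ := sub_pos.2 hlt
  have ht : 0 < t := lt_of_le_of_lt ht₁ hlt
  -- the translated solution on `[0, t − t₁]`
  have hS : IsClassicalNSSolutionOn (Icc 0 (t - t₁)) ν 0 (fun s => u (s + t₁)) (fun s => p (s + t₁)) :=
    (hsol.translate_Ico_zero ht₁).mono (Icc_subset_Ico_right (by linarith)) (uniqueDiffOn_Icc hL)
  have hB : HasBoundedSobolevNormsOn (Icc 0 (t - t₁)) (fun s => u (s + t₁)) := fun n =>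
    ((hreg t htT) n).imp fun _ hC s hs => hC (s + t₁) ⟨by linarith [hs.1], by linarith [hs.2]⟩
  have hb := hbud hν hL hS hB (t := t - t₁) ⟨hL.le, le_rfl⟩
  simp only [zero_add] at hb
  -- back to the original time variable and the `rpow` spelling of the enstrophy
  have hshift : ∫ s in (0 : ℝ)..(t - t₁), (eLpNorm (curl (u (s + t₁))) 2 volume).toReal =
      ∫ s in t₁..t, (eLpNorm (curl (u s)) 2 volume).toReal := by
    rw [intervalIntegral.integral_comp_add_right (fun s => (eLpNorm (curl (u s)) 2 volume).toReal) t₁,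
      zero_add, sub_add_cancel]
  have hcongr : ∫ s in t₁..t, (eLpNorm (curl (u s)) 2 volume).toReal =
      ∫ s in t₁..t, (∫ y, ‖curl (u s) y‖ ^ 2) ^ (1 / (2 : ℝ)) := by
    refine intervalIntegral.integral_congr fun s hs => ?_
    rw [uIcc_of_le hlt.le] at hs
    exact toReal_eLpNorm_curl_eq_rpow hsol hreg ht htT ⟨ht₁.trans hs.1, hs.2⟩
  rw [← hcongr, ← hshift]
  refine hb.trans ?_
  have hE := hrat ν T u p hν hsol hreg t₁ ⟨ht₁, hlt.trans htT⟩
  have h2 : C₁ * (∫ y, ‖u t₁ y‖ ^ 2) / ν ≤ C₁ * CT * (∫ y, ‖u 0 y‖ ^ 2) / ν := by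
    rw [mul_assoc]
    exact div_le_div_of_nonneg_right (mul_le_mul_of_nonneg_left hE hC₁0) hν.le
  exact mul_le_mul_of_nonneg_left (Real.sqrt_le_sqrt h2) (Real.sqrt_nonneg _)

/-! ### Plate N♭β «ShrinkingDissipationBudget» -/

/-- `∫_{t₁}^{t} (T − s)^{−3β} ds ≤ (T − t₁)^{1−3β}/(1 − 3β)` for `t < T`, `β < 1/3` (`integral_rpow` after
`s ↦ T − s`; the subtracted term `(T − t)^{1−3β}/(1−3β)` is nonnegative). -/
theorem integral_rpow_sub_le {T t₁ t β : ℝ} (htT : t < T) (hβ3 : β < 1 / 3) :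
    ∫ s in t₁..t, (T - s) ^ (-(3 * β)) ≤ (T - t₁) ^ (1 - 3 * β) / (1 - 3 * β) := by
  have h13 : 0 < 1 - 3 * β := by linarith
  rw [intervalIntegral.integral_comp_sub_left (fun x => x ^ (-(3 * β))) T,
    integral_rpow (Or.inl (by linarith : (-1 : ℝ) < -(3 * β)))]
  have hexp : -(3 * β) + 1 = 1 - 3 * β := by ring
  rw [hexp]
  have hTt : 0 ≤ (T - t) ^ (1 - 3 * β) := Real.rpow_nonneg (by linarith) _
  have : ((T - t₁) ^ (1 - 3 * β) - (T - t) ^ (1 - 3 * β)) / (1 - 3 * β) ≤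
      (T - t₁) ^ (1 - 3 * β) / (1 - 3 * β) :=
    div_le_div_of_nonneg_right (by linarith) h13.le
  exact this

/-- The square of the shrinking-ball weight: for `s < T`, `r₀ > 0`,
`((4π/(3(r₀(T−s)^β)³))^{1/2})² = (4π/(3r₀³))·(T − s)^{−3β}`. -/
theorem shrinkingWeight_sq {T s r₀ β : ℝ} (hs : s < T) (hr₀ : 0 < r₀) :
    ((4 * π / (3 * (r₀ * (T - s) ^ β) ^ 3)) ^ (1 / (2 : ℝ))) ^ 2 =
      4 * π / (3 * r₀ ^ 3) * (T - s) ^ (-(3 * β)) := by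
  have hTs : 0 < T - s := sub_pos.2 hs
  have hpow : 0 < (T - s) ^ β := Real.rpow_pos_of_pos hTs β
  have hnn : 0 ≤ 4 * π / (3 * (r₀ * (T - s) ^ β) ^ 3) := by positivity
  rw [← Real.sqrt_eq_rpow, Real.sq_sqrt hnn, mul_pow, Real.rpow_neg hTs.le,
    ← Real.rpow_natCast ((T - s) ^ β) 3, ← Real.rpow_mul hTs.le]
  have h3 : β * ((3 : ℕ) : ℝ) = 3 * β := by push_cast; ring
  rw [h3]
  have hne : (T - s) ^ (3 * β) ≠ 0 := (Real.rpow_pos_of_pos hTs _).ne'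
  field_simp

/-- plate N♭β «ShrinkingDissipationBudget» (nsreg-p1 ROUND-34 §A, `Sketch36A.lean` l.175), PROVED — the text verbatim:
universal `C ≥ 0`; in the frame, for `0 ≤ t₁ ≤ t < T`, `r₀ > 0`, `0 < β < 1/3`,
`∫_{t₁}^{t} (4π/(3(r₀(T−s)^β)³))^{1/2}(∫‖ω(s)‖²)^{1/2} ds ≤ (4π/(3r₀³))^{1/2}·((T−t₁)^{1−3β}/(1−3β))^{1/2}·√(C‖u(0)‖²₂/ν)`.
Proof: the LEAD's `exists_dissipation_budget_weighted` on the translated solution `u(t₁ + ·)` over `[0, t − t₁]` with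
the weight `k(s) = (4π/(3(r₀(T−t₁−s)^β)³))^{1/2}`, `∫ k² = (4π/(3r₀³))∫_{t₁}^{t}(T−σ)^{−3β}dσ ≤ (4π/(3r₀³))(T−t₁)^{1−3β}/(1−3β)`,
and `∫‖u(t₁)‖² ≤ C_T∫‖u(0)‖²`. -/
theorem shrinkingDissipationBudget : ∃ C : ℝ, 0 ≤ C ∧
    ∀ (ν T : ℝ) (u : ℝ → (EuclideanSpace ℝ (Fin 3)) → (EuclideanSpace ℝ (Fin 3)))
      (p : ℝ → (EuclideanSpace ℝ (Fin 3)) → ℝ), 0 < ν →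
      IsClassicalNSSolutionOn (Ico 0 T) ν 0 u p →
      (∀ T'' < T, HasBoundedSobolevNormsOn (Icc 0 T'') u) →
      ∀ (t₁ t r₀ β : ℝ), 0 ≤ t₁ → t₁ ≤ t → t < T → 0 < r₀ → 0 < β → β < 1 / 3 →
        ∫ s in t₁..t, (4 * π / (3 * (r₀ * (T - s) ^ β) ^ 3)) ^ (1 / (2 : ℝ)) *
            (∫ y, ‖curl (u s) y‖ ^ 2) ^ (1 / (2 : ℝ)) ≤
          (4 * π / (3 * r₀ ^ 3)) ^ (1 / (2 : ℝ)) * ((T - t₁) ^ (1 - 3 * β) / (1 - 3 * β)) ^ (1 / (2 : ℝ)) *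
            Real.sqrt (C * (∫ y, ‖u 0 y‖ ^ 2) / ν) := by
  obtain ⟨C₁, hC₁0, hbud⟩ := exists_dissipation_budget_weighted
  obtain ⟨CT, hCT0, hrat⟩ := exists_energy_ratio
  refine ⟨C₁ * CT, by positivity, ?_⟩
  intro ν T u p hν hsol hreg t₁ t r₀ β ht₁ ht₁t htT hr₀ hβ hβ3
  have h13 : 0 < 1 - 3 * β := by linarith
  rcases eq_or_lt_of_le ht₁t with heq | hlt
  · subst heq
    rw [intervalIntegral.integral_same]
    have hT1 : 0 < T - t₁ := sub_pos.2 htT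
    positivity
  have hL : 0 < t - t₁ := sub_pos.2 hlt
  have ht : 0 < t := lt_of_le_of_lt ht₁ hlt
  -- the translated solution on `[0, t − t₁]`
  have hS : IsClassicalNSSolutionOn (Icc 0 (t - t₁)) ν 0 (fun s => u (s + t₁)) (fun s => p (s + t₁)) :=
    (hsol.translate_Ico_zero ht₁).mono (Icc_subset_Ico_right (by linarith)) (uniqueDiffOn_Icc hL)
  have hB : HasBoundedSobolevNormsOn (Icc 0 (t - t₁)) (fun s => u (s + t₁)) := fun n =>
    ((hreg t htT) n).imp fun _ hC s hs => hC (s + t₁) ⟨by linarith [hs.1], by linarith [hs.2]⟩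
  -- the weight on the translated slab
  have hwpos : ∀ s ∈ Icc (0 : ℝ) (t - t₁), 0 < 3 * (r₀ * (T - (s + t₁)) ^ β) ^ 3 := by
    intro s hs
    have hTs : 0 < T - (s + t₁) := by linarith [hs.2]
    have := Real.rpow_pos_of_pos hTs β
    positivity
  have hkc : ContinuousOn (fun s : ℝ => (4 * π / (3 * (r₀ * (T - (s + t₁)) ^ β) ^ 3)) ^ (1 / (2 : ℝ)))
      (Icc 0 (t - t₁)) := by
    have h1 : ContinuousOn (fun s : ℝ => (T - (s + t₁)) ^ β) (Icc 0 (t - t₁)) :=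
      ((continuousOn_const.sub (continuousOn_id.add continuousOn_const)).rpow_const
        fun s _ => Or.inr hβ.le)
    have h2 : ContinuousOn (fun s : ℝ => 3 * (r₀ * (T - (s + t₁)) ^ β) ^ 3) (Icc 0 (t - t₁)) :=
      continuousOn_const.mul ((continuousOn_const.mul h1).pow 3)
    exact (continuousOn_const.div h2 fun s hs => (hwpos s hs).ne').rpow_const fun s _ =>
      Or.inr (by norm_num)
  have hk0 : ∀ s ∈ Icc (0 : ℝ) (t - t₁),
      0 ≤ (4 * π / (3 * (r₀ * (T - (s + t₁)) ^ β) ^ 3)) ^ (1 / (2 : ℝ)) := fun s hs =>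
    Real.rpow_nonneg (div_nonneg (by positivity) (hwpos s hs).le) _
  have hb := hbud hν hL hS hB hkc hk0 (t := t - t₁) ⟨hL.le, le_rfl⟩
  simp only [zero_add] at hb
  -- back to the original time variable
  have hshift : ∫ s in (0 : ℝ)..(t - t₁), (4 * π / (3 * (r₀ * (T - (s + t₁)) ^ β) ^ 3)) ^ (1 / (2 : ℝ)) *
        (eLpNorm (curl (u (s + t₁))) 2 volume).toReal =
      ∫ s in t₁..t, (4 * π / (3 * (r₀ * (T - s) ^ β) ^ 3)) ^ (1 / (2 : ℝ)) *
        (eLpNorm (curl (u s)) 2 volume).toReal := by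
    rw [intervalIntegral.integral_comp_add_right (fun s => (4 * π / (3 * (r₀ * (T - s) ^ β) ^ 3)) ^
      (1 / (2 : ℝ)) * (eLpNorm (curl (u s)) 2 volume).toReal) t₁, zero_add, sub_add_cancel]
  have hcongr : ∫ s in t₁..t, (4 * π / (3 * (r₀ * (T - s) ^ β) ^ 3)) ^ (1 / (2 : ℝ)) *
        (eLpNorm (curl (u s)) 2 volume).toReal =
      ∫ s in t₁..t, (4 * π / (3 * (r₀ * (T - s) ^ β) ^ 3)) ^ (1 / (2 : ℝ)) *
        (∫ y, ‖curl (u s) y‖ ^ 2) ^ (1 / (2 : ℝ)) := by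
    refine intervalIntegral.integral_congr fun s hs => ?_
    rw [uIcc_of_le hlt.le] at hs
    rw [toReal_eLpNorm_curl_eq_rpow hsol hreg ht htT ⟨ht₁.trans hs.1, hs.2⟩]
  -- the square-integral of the weight
  have hk2shift : ∫ s in (0 : ℝ)..(t - t₁), ((4 * π / (3 * (r₀ * (T - (s + t₁)) ^ β) ^ 3)) ^ (1 / (2 : ℝ))) ^ 2 =
      ∫ s in t₁..t, ((4 * π / (3 * (r₀ * (T - s) ^ β) ^ 3)) ^ (1 / (2 : ℝ))) ^ 2 := by
    rw [intervalIntegral.integral_comp_add_right (fun s => ((4 * π / (3 * (r₀ * (T - s) ^ β) ^ 3)) ^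
      (1 / (2 : ℝ))) ^ 2) t₁, zero_add, sub_add_cancel]
  have hk2 : ∫ s in t₁..t, ((4 * π / (3 * (r₀ * (T - s) ^ β) ^ 3)) ^ (1 / (2 : ℝ))) ^ 2 ≤
      4 * π / (3 * r₀ ^ 3) * ((T - t₁) ^ (1 - 3 * β) / (1 - 3 * β)) := by
    have hc : ∫ s in t₁..t, ((4 * π / (3 * (r₀ * (T - s) ^ β) ^ 3)) ^ (1 / (2 : ℝ))) ^ 2 =
        ∫ s in t₁..t, 4 * π / (3 * r₀ ^ 3) * (T - s) ^ (-(3 * β)) := by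
      refine intervalIntegral.integral_congr fun s hs => ?_
      rw [uIcc_of_le hlt.le] at hs
      exact shrinkingWeight_sq (lt_of_le_of_lt hs.2 htT) hr₀
    rw [hc, intervalIntegral.integral_const_mul]
    exact mul_le_mul_of_nonneg_left (integral_rpow_sub_le htT hβ3) (by positivity)
  -- assemble
  rw [← hcongr, ← hshift]
  refine hb.trans ?_
  rw [hk2shift]
  have hE := hrat ν T u p hν hsol hreg t₁ ⟨ht₁, hlt.trans htT⟩
  have h2 : C₁ * (∫ y, ‖u t₁ y‖ ^ 2) / ν ≤ C₁ * CT * (∫ y, ‖u 0 y‖ ^ 2) / ν := by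
    rw [mul_assoc]
    exact div_le_div_of_nonneg_right (mul_le_mul_of_nonneg_left hE hC₁0) hν.le
  have hT1 : 0 ≤ T - t₁ := by linarith
  have hQ : Real.sqrt (∫ s in t₁..t, ((4 * π / (3 * (r₀ * (T - s) ^ β) ^ 3)) ^ (1 / (2 : ℝ))) ^ 2) ≤
      (4 * π / (3 * r₀ ^ 3)) ^ (1 / (2 : ℝ)) * ((T - t₁) ^ (1 - 3 * β) / (1 - 3 * β)) ^ (1 / (2 : ℝ)) := by
    refine (Real.sqrt_le_sqrt hk2).trans (le_of_eq ?_)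
    rw [Real.sqrt_eq_rpow, Real.mul_rpow (by positivity) (by positivity)]
  calc Real.sqrt (∫ s in t₁..t, ((4 * π / (3 * (r₀ * (T - s) ^ β) ^ 3)) ^ (1 / (2 : ℝ))) ^ 2) *
        Real.sqrt (C₁ * (∫ y, ‖u t₁ y‖ ^ 2) / ν)
      ≤ ((4 * π / (3 * r₀ ^ 3)) ^ (1 / (2 : ℝ)) * ((T - t₁) ^ (1 - 3 * β) / (1 - 3 * β)) ^ (1 / (2 : ℝ))) *
          Real.sqrt (C₁ * CT * (∫ y, ‖u 0 y‖ ^ 2) / ν) :=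
        mul_le_mul hQ (Real.sqrt_le_sqrt h2) (Real.sqrt_nonneg _) (by positivity)
    _ = _ := by ring

end Summit.NavierStokesRegularity.NavierStokesRegularity.Theorems.ArgmaxDoors

end
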